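/- Width seat `ym-line-cbag-p1-w3` (prover-ym-line-cbag-p1-w3-g0-0), route `ColdBoxAllGroups`, crux `BoxFloorAllGroups`
(stmt-QuantumFields-22254), line `birth`, skeleton v4 / lead's PLAN v5: brick B2 «GoodReductionG» of stub S2. -/
import Summits.QuantumFields.YangMills.Theorems.ColdBoxAllGroupsOneScaleDefs
import Summits.QuantumFields.YangMills.Theorems.ColdBoxAllGroupsBulkAllGroupsDlrPlumbingG
import Summits.QuantumFields.YangMills.Theorems.WeakCouplingRatesColdBoxGoodEvent
import Literature.MathematicalPhysics.QuantumLattice.LatticeGaugeDLRGibbsProofs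

/-!
# Crux `BoxFloorAllGroups`, brick B2 «GoodReductionG»: reduction of `boxPlaqCov ρ` to the small-field conditioned box state,
# every compact group presented in `U(N)`

`G`-generic port of `WeakCouplingRatesColdBoxGoodReduction.abs_boxPlaqCov_sub_cond_le` (the `SU(2)` line `birth` of the proved crux
`ColdBoxTwoPointFloorW`) in the lead's vocabulary `ColdBoxAllGroupsOneScaleDefs` (`coldGoodSetG`): for a continuous unitary representation
`ρ : G →* U(N)`, `0 < θ`, `2θ < ε` and `H = ⌈β^θ⌉`, eventually in `β`,
* `boxState_real_compl_coldGoodSetG_le` — the bad event is rare: `boxState (coldGoodSetG)ᶜ ≤ exp(−β^ε)` (brick B1 / stub S1,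
  `boxState_largeField_rarity_of_rep`);
* `boxState_coldGoodSetG_ne_zero` — hence the good event is charged;
* integrability of the costs (`|plaqCostAt ρ x i j U| ≤ 2N`, the tree's `abs_plaqCostAt_leG`);
* **`abs_boxPlaqCov_sub_cond_le_of_rep`** — the connected two-point function `boxPlaqCov ρ β H T` of the two central plaquette costs
  under `boxState ρ β H` differs from the same connected two-point function under `boxState ρ β H` CONDITIONED on `coldGoodSetG ρ H β ε` by
  at most `24N²·exp(−β^ε)` (`abs_cov_sub_cov_cond_le` with `M_f = M_g = 2N`).
No sorry; no definition; standard axioms.  NOT a claim about the Yang–Mills mass gap (rung-level support, RECORD label).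
-/

set_option autoImplicit false

noncomputable section

open MeasureTheory ProbabilityTheory
open Literature.MathematicalPhysics.QuantumLattice
open Literature.MathematicalPhysics.QuantumFieldTheory
open Literature.MathematicalPhysics.QuantumFieldTheory.AxialGauge

namespace Summit.QuantumFields.YangMills.Theorems.ColdBoxAllGroups

open Summit.QuantumFields.YangMills.Theorems.WeakCouplingRates

variable {N : ℕ} {G : Type*} [Group G] [TopologicalSpace G] [IsTopologicalGroup G] [CompactSpace G]
  [MeasurableSpace G] [BorelSpace G] [SecondCountableTopology G]
variable (ρ : G →* Matrix (Fin N) (Fin N) ℂ) {H : ℕ}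

omit [CompactSpace G] in
/-- The plaquette cost is integrable under any finite measure (bounded and measurable). -/
theorem integrable_plaqCostAt_of_rep (hρc : Continuous ρ) (hρu : ∀ g, ρ g ∈ Matrix.unitaryGroup (Fin N) ℂ)
    (x : Literature.Probability.LatticeModels.Site 4) (i j : Fin 4) (μ : Measure (LGConfig 4 G)) [IsFiniteMeasure μ] :
    Integrable (plaqCostAt ρ x i j) μ :=
  integrable_of_bound (measurable_plaqCostAt_of_continuous ρ hρc x i j).aestronglyMeasurable (abs_plaqCostAt_leG ρ hρu x i j)

omit [CompactSpace G] in
/-- Products of two plaquette costs are integrable under any finite measure. -/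
theorem integrable_plaqCostAt_mul_of_rep (hρc : Continuous ρ) (hρu : ∀ g, ρ g ∈ Matrix.unitaryGroup (Fin N) ℂ)
    (x y : Literature.Probability.LatticeModels.Site 4) (i j : Fin 4) (μ : Measure (LGConfig 4 G)) [IsFiniteMeasure μ] :
    Integrable (fun U => plaqCostAt ρ x i j U * plaqCostAt ρ y i j U) μ :=
  integrable_of_bound ((measurable_plaqCostAt_of_continuous ρ hρc x i j).mul
    (measurable_plaqCostAt_of_continuous ρ hρc y i j)).aestronglyMeasurable (C := 2 * N * (2 * N))
    (fun U => by
      rw [abs_mul]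
      exact mul_le_mul (abs_plaqCostAt_leG ρ hρu x i j U) (abs_plaqCostAt_leG ρ hρu y i j U) (abs_nonneg _)
        (by positivity))

/-- **The bad event is rare** (brick B1 read through `coldGoodSetG`): for `0 < θ`, `2θ < ε`, eventually in `β`,
`boxState ρ β ⌈β^θ⌉ (coldGoodSetG ρ ⌈β^θ⌉ β ε)ᶜ ≤ exp(−β^ε)`. -/
theorem boxState_real_compl_coldGoodSetG_le (hρc : Continuous ρ) (hρu : ∀ g, ρ g ∈ Matrix.unitaryGroup (Fin N) ℂ)
    {θ ε : ℝ} (hθ : 0 < θ) (hε : 2 * θ < ε) :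
    ∃ β₀ : ℝ, ∀ β : ℝ, β₀ ≤ β →
      (boxState ρ β ⌈β ^ θ⌉₊).real (coldGoodSetG ρ ⌈β ^ θ⌉₊ β ε)ᶜ ≤ Real.exp (-(β ^ ε)) := by
  obtain ⟨β₀, hβ₀⟩ := boxState_largeField_rarity_of_rep ρ hρc hρu hθ hε
  refine ⟨β₀, fun β hβ => ?_⟩
  rw [coldGoodSetG, compl_compl]
  exact hβ₀ β hβ

/-- **The good event is charged**: for `0 < θ`, `2θ < ε`, eventually in `β`, `boxState ρ β ⌈β^θ⌉ (coldGoodSetG ρ ⌈β^θ⌉ β ε) ≠ 0`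
(indeed its complement has mass `≤ exp(−β^ε) < 1`). -/
theorem boxState_coldGoodSetG_ne_zero (hρc : Continuous ρ) (hρu : ∀ g, ρ g ∈ Matrix.unitaryGroup (Fin N) ℂ)
    {θ ε : ℝ} (hθ : 0 < θ) (hε : 2 * θ < ε) :
    ∃ β₀ : ℝ, ∀ β : ℝ, β₀ ≤ β → boxState ρ β ⌈β ^ θ⌉₊ (coldGoodSetG ρ ⌈β ^ θ⌉₊ β ε) ≠ 0 := by
  obtain ⟨β₀, hβ₀⟩ := boxState_real_compl_coldGoodSetG_le ρ hρc hρu hθ hε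
  refine ⟨max β₀ 1, fun β hβ => ?_⟩
  have hb0 : β₀ ≤ β := (le_max_left _ _).trans hβ
  have hβ1 : 1 ≤ β := (le_max_right _ _).trans hβ
  set μ := boxState ρ β ⌈β ^ θ⌉₊ with hμ
  haveI : IsProbabilityMeasure μ := by
    rw [hμ]; exact isProbabilityMeasure_ymSpecification _ hρc β _ _
  have hGm : MeasurableSet (coldGoodSetG ρ ⌈β ^ θ⌉₊ β ε) := measurableSet_coldGoodSetG ρ hρc β ε
  have hbad : μ.real (coldGoodSetG ρ ⌈β ^ θ⌉₊ β ε)ᶜ < 1 := lt_of_le_of_lt (hβ₀ β hb0) (by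
    rw [Real.exp_lt_one_iff]
    have : 0 < β ^ ε := Real.rpow_pos_of_pos (by linarith) ε
    linarith)
  intro h0
  have h1 : μ.real (coldGoodSetG ρ ⌈β ^ θ⌉₊ β ε) = 0 := by rw [measureReal_def, h0, ENNReal.toReal_zero]
  have h2 : μ.real (coldGoodSetG ρ ⌈β ^ θ⌉₊ β ε) + μ.real (coldGoodSetG ρ ⌈β ^ θ⌉₊ β ε)ᶜ = 1 := by
    rw [measureReal_add_measureReal_compl hGm, probReal_univ]
  linarith

/-- **Brick B2: conditioning the cold box of a compact group presented in `U(N)` on small fields costs `24N²·e^{−β^ε}`.**  For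
`0 < θ`, `ε > 2θ`, eventually in `β`, for every separation `T`, the connected two-point function `boxPlaqCov ρ β ⌈β^θ⌉ T` of the two
central plaquette costs under `boxState` differs from the same connected two-point function under `boxState` CONDITIONED on the
small-field event `coldGoodSetG ρ ⌈β^θ⌉ β ε` by at most `24N²·exp(−β^ε)` (`abs_cov_sub_cov_cond_le` with `|cost| ≤ 2N`, and B1). -/
theorem abs_boxPlaqCov_sub_cond_le_of_rep (hρc : Continuous ρ) (hρu : ∀ g, ρ g ∈ Matrix.unitaryGroup (Fin N) ℂ)
    {θ ε : ℝ} (hθ : 0 < θ) (hε : 2 * θ < ε) :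
    ∃ β₀ : ℝ, ∀ β : ℝ, β₀ ≤ β → ∀ T : ℕ,
      |boxPlaqCov ρ β ⌈β ^ θ⌉₊ T -
        ((∫ U, plaqCostAt ρ (boxCentre ⌈β ^ θ⌉₊) 1 2 U * plaqCostAt ρ (boxCentre ⌈β ^ θ⌉₊ + Pi.single 0 (T : ℤ)) 1 2 U
            ∂((boxState ρ β ⌈β ^ θ⌉₊)[|coldGoodSetG ρ ⌈β ^ θ⌉₊ β ε])) -
          (∫ U, plaqCostAt ρ (boxCentre ⌈β ^ θ⌉₊) 1 2 U ∂((boxState ρ β ⌈β ^ θ⌉₊)[|coldGoodSetG ρ ⌈β ^ θ⌉₊ β ε])) *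
          (∫ U, plaqCostAt ρ (boxCentre ⌈β ^ θ⌉₊ + Pi.single 0 (T : ℤ)) 1 2 U
            ∂((boxState ρ β ⌈β ^ θ⌉₊)[|coldGoodSetG ρ ⌈β ^ θ⌉₊ β ε])))| ≤
        24 * (N : ℝ) ^ 2 * Real.exp (-(β ^ ε)) := by
  obtain ⟨β₀, hβ₀⟩ := boxState_real_compl_coldGoodSetG_le ρ hρc hρu hθ hε
  obtain ⟨β₁, hβ₁⟩ := boxState_coldGoodSetG_ne_zero ρ hρc hρu hθ hε
  refine ⟨max β₀ β₁, fun β hβ T => ?_⟩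
  have hb0 : β₀ ≤ β := (le_max_left _ _).trans hβ
  have hb1 : β₁ ≤ β := (le_max_right _ _).trans hβ
  set Hh := ⌈β ^ θ⌉₊ with hH
  set μ := boxState ρ β Hh with hμ
  haveI : IsProbabilityMeasure μ := by
    rw [hμ]; exact isProbabilityMeasure_ymSpecification _ hρc β _ _
  set Gd := coldGoodSetG ρ Hh β ε with hG
  have hGm : MeasurableSet Gd := measurableSet_coldGoodSetG ρ hρc β ε
  have hbad : μ.real Gdᶜ ≤ Real.exp (-(β ^ ε)) := hβ₀ β hb0
  have hG0 : μ Gd ≠ 0 := hβ₁ β hb1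
  set f := plaqCostAt (d := 4) ρ (boxCentre Hh) 1 2 with hf
  set g := plaqCostAt (d := 4) ρ (boxCentre Hh + Pi.single 0 (T : ℤ)) 1 2 with hg
  have key := abs_cov_sub_cov_cond_le (μ := μ) hGm hG0 (integrable_plaqCostAt_of_rep ρ hρc hρu _ _ _ μ)
    (integrable_plaqCostAt_of_rep ρ hρc hρu _ _ _ μ) (integrable_plaqCostAt_mul_of_rep ρ hρc hρu _ _ _ _ μ)
    (abs_plaqCostAt_leG ρ hρu (boxCentre Hh) 1 2) (abs_plaqCostAt_leG ρ hρu (boxCentre Hh + Pi.single 0 (T : ℤ)) 1 2)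
  have hcov : boxPlaqCov ρ β Hh T = (∫ U, f U * g U ∂μ) - (∫ U, f U ∂μ) * (∫ U, g U ∂μ) := rfl
  rw [hcov]
  calc _ ≤ 6 * (2 * (N : ℝ)) * (2 * N) * μ.real Gdᶜ := key
    _ ≤ 24 * (N : ℝ) ^ 2 * Real.exp (-(β ^ ε)) := by
        have h0 : (0 : ℝ) ≤ μ.real Gdᶜ := measureReal_nonneg
        nlinarith [hbad, sq_nonneg (N : ℝ)]

end Summit.QuantumFields.YangMills.Theorems.ColdBoxAllGroups

end
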